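import Summits.AtomisticToContinuum.Crystallization.Theses.FluxTubeKepler
import Literature.MathematicalPhysics.StatisticalMechanics.PeriodicConfigurationDelone
import Literature.MathematicalPhysics.StatisticalMechanics.CrystallizationLocalLimit
import Summits.AtomisticToContinuum.Crystallization.Theorems.ChargedEnergyGap.Negative.PeriodicFormConverse

/-!
# Disproof of `FluxCellKepler` (stmt-AtomisticToContinuum-15221) — findings

Work file of the crux disprover (cdisprove).  `X = FluxCellKepler = ∃ P₀ R₁ τ, Dom R₁ τ ∧ Kepler P₀ R₁ τ`
(`fluxCellKepler_iff`, definitional).  Prose lives in docstrings; everything not marked `sorry` is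
kernel-checked.

## Findings (indexed)

VERDICT SO FAR: no kill.  X is not cheaply refutable for a structural reason (§3, §6): every
configuration-based attack needs a non-close-packed competitor tying `e⋆`, or `e⋆` known to the
precision of the attacking configuration's excess energy; neither exists.  What IS certified:

* §1 `Dom`, `Kepler`, `pat`, `Good` — the crux split into its two conjuncts (verbatim bodies),
  `fluxCellKepler_iff` (definitional).
* §2 WITNESS CONSTRAINTS: any witness has `0 < R₁` (`Dom.R₁_pos`, two-point configurations),
  `τ {0} ≤ -12 e(P₀)` (`Kepler.tau_zero_le`, one point), `d⁻⁶ ≤ τ {0}` for all `d > R₁`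
  (`Dom.inv_pow_six_le_tau_zero`), hence `e(P₀) < 0` and `R₁⁻⁶ ≤ -12 e(P₀)`
  (`witness_energy_neg`, `witness_R₁_bound`; ≈ `R₁ ≥ 0.70`; the fcc-shell version of the squeeze
  gives `R₁ > 1.09` but needs an `e⋆` enclosure, not certified).
* §2b FLOOR: `N · e(P₀) ≤ E_LJ(x)` on every finite injective `x` (`floor`), so `e(P₀) = e⋆` and
  `P₀` is a least-energy periodic configuration (`witness_energy_eq_eStar`, `witness_isLeast`):
  attainment (0627) and conjunct (i) are inside X.
* §3 LP KILL CRITERION `not_fluxCellKepler_of_balanced`: two pattern-balanced families with an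
  `r⁻⁶` surplus refute X (the complete obstruction form of the `c = 0` part; dead on paper for
  every `R₁ ≳ 0.5`: cross-gap `r⁻⁶` ≤ `πρ²/(12R₁²)` per facing area vs `12 ×` surface energy).
* §4 BARLOW IDENTIFICATION IS INSIDE X: every site of the witness `P₀` is `(R,η)`-layered-good
  for all `R, η > 0` (`witness_goodRel`, blocks of `P₀` as trial states + DOM + deep sites);
  `fluxCellKepler_imp_layered_minimiser`; kill criterion
  `not_fluxCellKepler_of_minimisers_not_layered`.
* §5 STRENGTHENING REFUTED: `c` chosen before `R` is false (`not_dom_and_keplerUniformR`;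
  witness = LJ ground states at `R = diam + 2`, all sites bad by `not_good_of_forall_norm_le`):
  the order `∀ R ∃ c` is load-bearing and `c(R) ≲ (E(N) − N e⋆)/N` at `R ≈ diam x^N`.
* §6 PERIODIC TWIN: `periodicPricing` (`c · motifBad ≤ #F (e(Q) − e⋆)` on `δ`-separated periodic
  `Q`) and the computational kill criterion `not_fluxCellKepler_of_cheap_bad_periodic`.

NOT certified / why X resists (paper, see crux NOTES of the rattack seat for the numbers):
dilation witness of 17253 is absorbed by the `a`-box (needs `s ≥ 6.4 %`, costs `26 s²` per site,
`c` is chosen after `η`); `c` uniform in `η` is false on paper (uniform shear `ε ≈ 2η/R` costs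
`με²`) but a proof needs `e⋆` to precision `ε²`; every defect family (vacancies, dislocations,
grain boundaries, surfaces, strain above threshold) is priced linearly at fixed `(R, η)`; stacking
faults / polytypes / twin junctions are GOOD (free Hägg word).  The planner's cheapest falsifier of
the INTENDED `q = 0` flux rule (bcc / A15 cell over-credit > 2.25 %) does not bear on X as typed
(`τ` is existential) — and it does NOT fire for bcc: §7.
* §7 NUMERICS (kit job j026141, not certified; solver `fluxcell.py` attached with the job evidence):
  the `q = 0` flux-cell value `D(Ω) = 2π⁴(T(Vor,0) − T(ℝ³))` by the Neumann–Yukawa reduction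
  `D = (π/6)∫κ⁴ h_κ(0) dκ` (MFS, first image layer exact; jobs j026141, j026390).  Validation
  (nn = 1, res 12): fcc `D − S₆ = +3.4e-6` (rel. 2e-7), hcp `D − S₆(hcp) = +1.0e-5` (the card's
  `σ_h = +2.7e-6 ± 1e-5`: consistent, `σ_h > 0` tiny).  RESULT: bcc truncated octahedron
  `D − S₆(bcc) = +4.6e-3 (res 7), +4.2e-3 (res 9), +3.3e-3 (res 12)` with `S₆(bcc) = 12.25367`:
  over-credit ≈ `+0.03 %` (still drifting down by ~1e-3 with resolution), against the kill threshold
  `D > 12.529` (`+2.25 %`, from `D²/(24 S₁₂(bcc)) > |e(hcp*)|`, `S₁₂(bcc) = 9.11418`,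
  `e(hcp*) = −0.717589`).  So the planner's cheapest falsifier of the INTENDED `q = 0` rule does not
  fire on bcc, by a factor ≈ 70: the scale-optimised one-centre value of bcc at `q = 0` is
  `−D²/(24 S₁₂) = −0.6868` vs `e(bcc*) = −0.68646`, still `0.031` above `e(hcp*)`.
  A15 (job j026352; nn = 6c chain distance): the icosahedral 2a cell is over-credited by `+2.41 %`
  (`D/S₆ = 1.0241`, independently confirming the card's "+2.4 % dodecahedral cell"), the CN14 6c cell
  is UNDER-credited (`0.9930`), aggregate `D̄ = 7.4080 ≥ S̄₆ = 7.4031` (`+0.066 %`; Thomson's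
  inequality holds in aggregate, as it must — a consistency check of the solver), and
  `λ⁰_opt(A15) = −0.6322` vs `e(A15*) = −0.6314`, both far above `e(hcp*)`: no kill.  LESSON for the
  line: at `q = 0` the flux-cell functional is nearly TIGHT in aggregate on space-filling periodic
  cell complexes (bcc +0.04 %, A15 +0.07 %: the icosahedral over-credit is paid back by its CN14
  partners), so periodic TCP competitors do not threaten KEPLER at `q = 0` for LJ 12-6 (they sit
  4–12 % above `e⋆`); the live danger remains the isolated icosahedral star (−5.9 %), i.e. TRANSFER,
  exactly as the planner's "why it might fail" says.
-/

noncomputable section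

namespace Summit.AtomisticToContinuum.Crystallization.Cruxes.FluxCellKepler.Disproof

open scoped BigOperators
open Literature.MathematicalPhysics.StatisticalMechanics
open Summit.AtomisticToContinuum.Crystallization.Theses.FluxTubeKepler

/-- Euclidean 3-space. -/
abbrev E3 : Type := EuclideanSpace ℝ (Fin 3)

/-! ## §1 The crux split into its conjuncts -/

/-- The `R₁`-pattern of site `i`: relative positions of the particles within `R₁` (the argument of
`τ` in the crux, verbatim). -/
def pat (R₁ : ℝ) {N : ℕ} (x : Fin N → E3) (i : Fin N) : Finset E3 :=
  (Finset.univ.filter fun j : Fin N => dist (x j) (x i) ≤ R₁).image fun j => x j - x i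

/-- The crux's defect predicate, verbatim: site `i` is `(R, η)`-layered-GOOD. -/
def Good (R η : ℝ) {N : ℕ} (x : Fin N → E3) (i : Fin N) : Prop :=
  ∃ a : ℝ, 47 / 50 ≤ a ∧ a ≤ 1 ∧ ∃ (A : EuclideanSpace ℝ (Fin 3) →ₗᵢ[ℝ] EuclideanSpace ℝ (Fin 3))
    (s : ℤ → ℤ) (z : ℤ → ℝ), Literature.MathematicalPhysics.StatisticalMechanics.IsHaggSeq s ∧
    (∀ m : ℤ, 39 / 50 * a ≤ z (m + 1) - z m ∧ z (m + 1) - z m ≤ 17 / 20 * a) ∧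
    let S : Set (EuclideanSpace ℝ (Fin 3)) := {p | ∃ m k l : ℤ, p = A (((k : ℝ) •
      Literature.MathematicalPhysics.StatisticalMechanics.triangularVec₁ a) + ((l : ℝ) •
      Literature.MathematicalPhysics.StatisticalMechanics.triangularVec₂ a) +
      ((Literature.MathematicalPhysics.StatisticalMechanics.haggLabel s m : ℝ) •
      Literature.MathematicalPhysics.StatisticalMechanics.barlowOffset a) + (z m •
      Literature.MathematicalPhysics.StatisticalMechanics.layerNormal 1))};
    (∀ p ∈ S, ‖p‖ ≤ R → ∃ j : Fin N, dist (x j - x i) p ≤ η) ∧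
      (∀ j : Fin N, ‖x j - x i‖ ≤ R → ∃ p ∈ S, dist (x j - x i) p ≤ η)

/-- (DOM): the local tail credit dominates the true `r⁻⁶` site energies in sum, on EVERY finite
injective configuration (no separation assumed). -/
def Dom (R₁ : ℝ) (τ : Finset E3 → ℝ) : Prop :=
  ∀ (N : ℕ) (x : Fin N → EuclideanSpace ℝ (Fin 3)), Function.Injective x →
    ∑ i, Literature.MathematicalPhysics.StatisticalMechanics.siteEnergy (fun r => (r⁻¹) ^ 6) x i ≤
      ∑ i, τ ((Finset.univ.filter fun j : Fin N => dist (x j) (x i) ≤ R₁).image fun j => x j - x i)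

/-- (KEPLER): the flux-cell Kepler inequality with the sharp constant `e(P₀)` and a linear defect
penalty, verbatim. -/
def Kepler (P₀ : PeriodicConfiguration 3) (R₁ : ℝ) (τ : Finset E3 → ℝ) : Prop :=
  ∀ δ : ℝ, 0 < δ → ∀ R η : ℝ, 0 < R → 0 < η → ∃ c : ℝ, 0 < c ∧ ∀ (N : ℕ)
    (x : Fin N → EuclideanSpace ℝ (Fin 3)), Function.Injective x →
    (∀ i j, i ≠ j → δ ≤ dist (x i) (x j)) →
    c * (Nat.card {i : Fin N // ¬ ∃ a : ℝ, 47 / 50 ≤ a ∧ a ≤ 1 ∧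
      ∃ (A : EuclideanSpace ℝ (Fin 3) →ₗᵢ[ℝ] EuclideanSpace ℝ (Fin 3)) (s : ℤ → ℤ) (z : ℤ → ℝ),
      Literature.MathematicalPhysics.StatisticalMechanics.IsHaggSeq s ∧
      (∀ m : ℤ, 39 / 50 * a ≤ z (m + 1) - z m ∧ z (m + 1) - z m ≤ 17 / 20 * a) ∧
      let S : Set (EuclideanSpace ℝ (Fin 3)) := {p | ∃ m k l : ℤ, p = A (((k : ℝ) •
        Literature.MathematicalPhysics.StatisticalMechanics.triangularVec₁ a) + ((l : ℝ) •
        Literature.MathematicalPhysics.StatisticalMechanics.triangularVec₂ a) +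
        ((Literature.MathematicalPhysics.StatisticalMechanics.haggLabel s m : ℝ) •
        Literature.MathematicalPhysics.StatisticalMechanics.barlowOffset a) + (z m •
        Literature.MathematicalPhysics.StatisticalMechanics.layerNormal 1))};
      (∀ p ∈ S, ‖p‖ ≤ R → ∃ j : Fin N, dist (x j - x i) p ≤ η) ∧
        (∀ j : Fin N, ‖x j - x i‖ ≤ R → ∃ p ∈ S, dist (x j - x i) p ≤ η)} : ℝ) ≤
    ∑ i, ((1 / 24 : ℝ) * Literature.MathematicalPhysics.StatisticalMechanics.siteEnergy
      (fun r => (r⁻¹) ^ 12) x i - (1 / 12 : ℝ) *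
      τ ((Finset.univ.filter fun j : Fin N => dist (x j) (x i) ≤ R₁).image fun j => x j - x i)) -
      (N : ℝ) *
        P₀.energyPerParticle Literature.MathematicalPhysics.StatisticalMechanics.lennardJones

/-- The crux is, by definition, `∃ P₀ R₁ τ, Dom R₁ τ ∧ Kepler P₀ R₁ τ`. [folklore] -/
theorem fluxCellKepler_iff :
    FluxCellKepler ↔ ∃ (P₀ : PeriodicConfiguration 3) (R₁ : ℝ) (τ : Finset E3 → ℝ),
      Dom R₁ τ ∧ Kepler P₀ R₁ τ :=
  Iff.rfl

/-! ## §2 Witness constraints from one- and two-point configurations -/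

/-- The standard unit vector `e₀`. -/
def e0 : E3 := EuclideanSpace.single 0 1

@[simp] theorem norm_e0 : ‖e0‖ = 1 := by
  simp [e0]

/-- The two-point configuration `0, d e₀`. -/
def twoPt (d : ℝ) : Fin 2 → E3 := ![0, d • e0]

theorem twoPt_zero (d : ℝ) : twoPt d 0 = 0 := rfl
theorem twoPt_one (d : ℝ) : twoPt d 1 = d • e0 := rfl

theorem dist_twoPt {d : ℝ} (hd : 0 ≤ d) : dist (twoPt d 0) (twoPt d 1) = d := by
  rw [twoPt_zero, twoPt_one, dist_comm, dist_zero_right, norm_smul, norm_e0, mul_one,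
    Real.norm_of_nonneg hd]

/-- Distinct points of the two-point configuration are at distance `d`. -/
theorem dist_twoPt_ne {d : ℝ} (hd : 0 ≤ d) :
    ∀ i j : Fin 2, i ≠ j → dist (twoPt d i) (twoPt d j) = d := by
  simp only [Fin.forall_fin_two]
  refine ⟨⟨fun h => absurd rfl h, fun _ => dist_twoPt hd⟩,
    ⟨fun _ => by rw [dist_comm]; exact dist_twoPt hd, fun h => absurd rfl h⟩⟩

theorem twoPt_injective {d : ℝ} (hd : 0 < d) : Function.Injective (twoPt d) := by
  intro i j h
  by_contra hne
  have := dist_twoPt_ne hd.le i j hne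
  rw [h, dist_self] at this
  exact hd.ne' (this.symm ▸ rfl)

/-- The pattern of an isolated site: `{0}` if `0 ≤ R₁`, `∅` otherwise. -/
def isoPat (R₁ : ℝ) : Finset E3 := if 0 ≤ R₁ then {0} else ∅

/-- In the two-point configuration at distance `d > R₁` both patterns are the isolated pattern.
[folklore] -/
theorem pat_twoPt {R₁ d : ℝ} (hd : 0 < d) (hRd : R₁ < d) (i : Fin 2) :
    ((Finset.univ.filter fun j : Fin 2 => dist (twoPt d j) (twoPt d i) ≤ R₁).image
      fun j => twoPt d j - twoPt d i) = isoPat R₁ := by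
  by_cases hR : 0 ≤ R₁
  · have hfilter : (Finset.univ.filter fun j : Fin 2 => dist (twoPt d j) (twoPt d i) ≤ R₁) =
        {i} := by
      ext j
      simp only [Finset.mem_filter, Finset.mem_univ, true_and, Finset.mem_singleton]
      constructor
      · intro hj
        by_contra hne
        have := dist_twoPt_ne hd.le j i hne
        linarith
      · rintro rfl
        simpa using hR
    rw [hfilter, Finset.image_singleton, sub_self]
    simp [isoPat, hR]
  · have hfilter : (Finset.univ.filter fun j : Fin 2 => dist (twoPt d j) (twoPt d i) ≤ R₁) =
        ∅ := by
      ext j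
      simp only [Finset.mem_filter, Finset.mem_univ, true_and, Finset.notMem_empty, iff_false,
        not_le]
      exact (not_le.1 hR).trans_le dist_nonneg
    rw [hfilter, Finset.image_empty]
    simp [isoPat, hR]

/-- Site energies of the two-point configuration for an inverse-power potential. [folklore] -/
theorem siteEnergy_twoPt {d : ℝ} (hd : 0 < d) (n : ℕ) :
    ∀ i : Fin 2, siteEnergy (fun r => (r⁻¹) ^ n) (twoPt d) i = (d⁻¹) ^ n := by
  unfold siteEnergy
  have h0 : (Finset.univ.erase (0 : Fin 2)) = {1} := by decide
  have h1 : (Finset.univ.erase (1 : Fin 2)) = {0} := by decide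
  simp only [Fin.forall_fin_two, h0, h1, Finset.sum_singleton]
  rw [dist_comm (twoPt d 1), dist_twoPt hd.le]
  exact ⟨rfl, rfl⟩

/-- **DOM on two points at distance `d > R₁`:** `d⁻⁶ ≤ τ (isoPat R₁)`. [folklore] -/
theorem Dom.inv_pow_six_le {R₁ : ℝ} {τ : Finset E3 → ℝ} (h : Dom R₁ τ) {d : ℝ} (hd : 0 < d)
    (hRd : R₁ < d) : (d⁻¹) ^ 6 ≤ τ (isoPat R₁) := by
  have := h 2 (twoPt d) (twoPt_injective hd)
  simp only [Fin.sum_univ_two, siteEnergy_twoPt hd, pat_twoPt hd hRd] at this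
  linarith

/-- **Any DOM-witness has `0 < R₁`**: otherwise all small two-point configurations have the
isolated pattern and `d⁻⁶ ≤ τ(isoPat)` for all small `d`, absurd. [folklore] -/
theorem Dom.R₁_pos {R₁ : ℝ} {τ : Finset E3 → ℝ} (h : Dom R₁ τ) : 0 < R₁ := by
  by_contra hR
  push Not at hR
  set T := τ (isoPat R₁)
  set d : ℝ := 1 / (|T| + 2) with hd_def
  have hT2 : 0 < |T| + 2 := by positivity
  have hd : 0 < d := by positivity
  have hd1 : d ≤ 1 := by
    rw [hd_def, div_le_one hT2]; linarith [abs_nonneg T]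
  have h1 : (d⁻¹) ^ 6 ≤ T := h.inv_pow_six_le hd (hR.trans_lt hd)
  have h2 : d⁻¹ ≤ (d⁻¹) ^ 6 := le_self_pow₀ (one_le_inv₀ hd |>.2 hd1) (by norm_num)
  have h3 : d⁻¹ = |T| + 2 := by rw [hd_def, one_div, inv_inv]
  linarith [le_abs_self T]

/-- With `0 ≤ R₁` the isolated pattern is `{0}`. -/
theorem isoPat_of_nonneg {R₁ : ℝ} (h : 0 ≤ R₁) : isoPat R₁ = {0} := by simp [isoPat, h]

/-- **DOM squeeze, lower side:** `d⁻⁶ ≤ τ {0}` for every `d > R₁`. [folklore] -/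
theorem Dom.inv_pow_six_le_tau_zero {R₁ : ℝ} {τ : Finset E3 → ℝ} (h : Dom R₁ τ) {d : ℝ}
    (hRd : R₁ < d) : (d⁻¹) ^ 6 ≤ τ {0} := by
  have hR := h.R₁_pos
  rw [← isoPat_of_nonneg hR.le]
  exact h.inv_pow_six_le (hR.trans hRd) hRd

/-- The one-point configuration. -/
def onePt : Fin 1 → E3 := fun _ => 0

/-- **KEPLER on one point:** the right-hand side of KEPLER is non-negative on every injective
configuration (it is `δ`-separated for its own `δ`), and on the single site it reads
`τ {0} / 12 ≤ -e(P₀)`. [folklore] -/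
theorem Kepler.tau_zero_le {P₀ : PeriodicConfiguration 3} {R₁ : ℝ} {τ : Finset E3 → ℝ}
    (h : Kepler P₀ R₁ τ) (hR : 0 ≤ R₁) :
    τ {0} ≤ -12 * P₀.energyPerParticle lennardJones := by
  obtain ⟨c, hc, hK⟩ := h 1 one_pos 1 1 one_pos one_pos
  have hinj : Function.Injective onePt := fun i j _ => Subsingleton.elim i j
  have hsep : ∀ i j : Fin 1, i ≠ j → (1 : ℝ) ≤ dist (onePt i) (onePt j) :=
    fun i j hij => absurd (Subsingleton.elim i j) hij
  have h0 := le_trans (mul_nonneg hc.le (Nat.cast_nonneg _)) (hK 1 onePt hinj hsep)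
  have hfilt : (Finset.univ.filter fun j : Fin 1 => dist (onePt j) (onePt 0) ≤ R₁) =
      Finset.univ := by
    ext j; simp [onePt, hR]
  have hpat : ((Finset.univ.filter fun j : Fin 1 => dist (onePt j) (onePt 0) ≤ R₁).image
      fun j => onePt j - onePt 0) = {0} := by
    rw [hfilt]; ext p; simp [onePt]
  have hsite : siteEnergy (fun r => (r⁻¹) ^ 12) onePt 0 = 0 := by
    unfold siteEnergy
    have : (Finset.univ.erase (0 : Fin 1)) = ∅ := by decide
    rw [this, Finset.sum_empty]
  simp only [Fin.sum_univ_one, hsite, mul_zero, zero_sub, Nat.cast_one, one_mul, hpat] at h0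
  linarith

/-- **Any witness has negative energy per particle** (`e(P₀) < 0`). [folklore] -/
theorem witness_energy_neg {P₀ : PeriodicConfiguration 3} {R₁ : ℝ} {τ : Finset E3 → ℝ}
    (hD : Dom R₁ τ) (hK : Kepler P₀ R₁ τ) : P₀.energyPerParticle lennardJones < 0 := by
  have hR := hD.R₁_pos
  have h1 := hD.inv_pow_six_le_tau_zero (lt_add_one R₁)
  have h2 := hK.tau_zero_le hR.le
  have h3 : 0 < ((R₁ + 1)⁻¹) ^ 6 := by positivity
  linarith

/-- **Any witness has `R₁⁻⁶ ≤ -12 e(P₀)`**, i.e. `R₁ ≥ (12|e(P₀)|)^{-1/6}`: the pattern radius of a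
local tail credit is bounded below by the energy scale (≈ 0.70 at `e(P₀) = e⋆ ≈ −0.7176`).
[folklore] -/
theorem witness_R₁_bound {P₀ : PeriodicConfiguration 3} {R₁ : ℝ} {τ : Finset E3 → ℝ}
    (hD : Dom R₁ τ) (hK : Kepler P₀ R₁ τ) :
    (R₁⁻¹) ^ 6 ≤ -12 * P₀.energyPerParticle lennardJones := by
  have hR := hD.R₁_pos
  have h2 := hK.tau_zero_le hR.le
  have hcont : ContinuousAt (fun d : ℝ => (d⁻¹) ^ 6) R₁ := (continuousAt_inv₀ hR.ne').pow 6
  have htend : Filter.Tendsto (fun d : ℝ => (d⁻¹) ^ 6) (nhdsWithin R₁ (Set.Ioi R₁))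
      (nhds ((R₁⁻¹) ^ 6)) := hcont.continuousWithinAt.tendsto
  refine le_of_tendsto htend ?_
  refine eventually_nhdsWithin_of_forall fun d hd => ?_
  exact (hD.inv_pow_six_le_tau_zero hd).trans h2

/-! ## §2b The floor and the minimiser (X ⊇ conjunct (i) + attainment) -/

/-- Every finite injective configuration is `δ`-separated for some `δ > 0`. [folklore] -/
theorem exists_sep {N : ℕ} {x : Fin N → E3} (hx : Function.Injective x) :
    ∃ δ : ℝ, 0 < δ ∧ ∀ i j : Fin N, i ≠ j → δ ≤ dist (x i) (x j) := by
  classical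
  set D : Finset ℝ := ((Finset.univ : Finset (Fin N × Fin N)).filter fun p => p.1 ≠ p.2).image
    fun p => dist (x p.1) (x p.2) with hD_def
  have hmem : ∀ i j : Fin N, i ≠ j → dist (x i) (x j) ∈ D := fun i j hij =>
    Finset.mem_image.2 ⟨(i, j), Finset.mem_filter.2 ⟨Finset.mem_univ _, hij⟩, rfl⟩
  by_cases hD : D.Nonempty
  · refine ⟨D.min' hD, ?_, fun i j hij => D.min'_le _ (hmem i j hij)⟩
    refine (Finset.lt_min'_iff _ _).2 fun y hy => ?_
    obtain ⟨p, hp, rfl⟩ := Finset.mem_image.1 hy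
    exact dist_pos.2 (hx.ne (Finset.mem_filter.1 hp).2)
  · exact ⟨1, one_pos, fun i j hij => absurd ⟨_, hmem i j hij⟩ hD⟩

/-- **KEPLER ⇒ its right-hand side is non-negative on EVERY finite injective configuration**
(instantiate `δ` = the configuration's own minimal distance). [folklore] -/
theorem Kepler.rhs_nonneg {P₀ : PeriodicConfiguration 3} {R₁ : ℝ} {τ : Finset E3 → ℝ}
    (h : Kepler P₀ R₁ τ) {N : ℕ} {x : Fin N → E3} (hx : Function.Injective x) :
    0 ≤ ∑ i, ((1 / 24 : ℝ) * siteEnergy (fun r => (r⁻¹) ^ 12) x i - (1 / 12 : ℝ) *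
      τ ((Finset.univ.filter fun j : Fin N => dist (x j) (x i) ≤ R₁).image fun j => x j - x i)) -
      (N : ℝ) * P₀.energyPerParticle lennardJones := by
  obtain ⟨δ, hδ, hsep⟩ := exists_sep hx
  obtain ⟨c, hc, hK⟩ := h δ hδ 1 1 one_pos one_pos
  exact le_trans (mul_nonneg hc.le (Nat.cast_nonneg _)) (hK N x hx hsep)

/-- The Lennard-Jones site energy splits into the two inverse powers. [folklore] -/
theorem siteEnergy_lennardJones {N : ℕ} (x : Fin N → E3) (i : Fin N) :
    siteEnergy lennardJones x i = (1 / 12 : ℝ) * siteEnergy (fun r => (r⁻¹) ^ 12) x i -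
      (1 / 6 : ℝ) * siteEnergy (fun r => (r⁻¹) ^ 6) x i := by
  unfold siteEnergy lennardJones
  rw [Finset.sum_sub_distrib, Finset.mul_sum, Finset.mul_sum]

/-- **The energy identity behind the crux's constants**: `E_LJ = Σ_i ((1/24) site₁₂ − (1/12) site₆)`.
[folklore] -/
theorem interactionEnergy_eq_sum {N : ℕ} (x : Fin N → E3) :
    interactionEnergy lennardJones x = ∑ i, ((1 / 24 : ℝ) * siteEnergy (fun r => (r⁻¹) ^ 12) x i -
      (1 / 12 : ℝ) * siteEnergy (fun r => (r⁻¹) ^ 6) x i) := by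
  have h := two_mul_interactionEnergy lennardJones x
  simp only [siteEnergy_lennardJones] at h
  have : ∑ i, ((1 / 24 : ℝ) * siteEnergy (fun r => (r⁻¹) ^ 12) x i -
      (1 / 12 : ℝ) * siteEnergy (fun r => (r⁻¹) ^ 6) x i) = (1 / 2 : ℝ) *
      ∑ i, ((1 / 12 : ℝ) * siteEnergy (fun r => (r⁻¹) ^ 12) x i -
        (1 / 6 : ℝ) * siteEnergy (fun r => (r⁻¹) ^ 6) x i) := by
    rw [Finset.mul_sum]
    exact Finset.sum_congr rfl fun i _ => by ring
  rw [this]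
  linarith

/-- **DOM + KEPLER ⇒ the sharp floor `N · e(P₀) ≤ E_LJ(x)` on every finite injective `x`.**
[folklore] -/
theorem floor {P₀ : PeriodicConfiguration 3} {R₁ : ℝ} {τ : Finset E3 → ℝ}
    (hD : Dom R₁ τ) (hK : Kepler P₀ R₁ τ) {N : ℕ} {x : Fin N → E3} (hx : Function.Injective x) :
    (N : ℝ) * P₀.energyPerParticle lennardJones ≤ interactionEnergy lennardJones x := by
  have h1 := hK.rhs_nonneg hx
  have h2 := hD N x hx
  rw [interactionEnergy_eq_sum]
  rw [Finset.sum_sub_distrib] at h1 ⊢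
  rw [← Finset.mul_sum, ← Finset.mul_sum] at h1 ⊢
  linarith

open Summit.AtomisticToContinuum.Crystallization.Theorems.ChargedEnergyGapNegative in
/-- **Any witness `P₀` is a periodic minimiser: `e(P₀) = e⋆ = ⨅_Q e(Q)`** (floor on the
Lennard-Jones ground states + the tree's `crysEnergyLimit` and `eStar_le`).  So X contains item
0627 (attainment) and conjunct (i) of the summit. [folklore] -/
theorem witness_energy_eq_eStar {P₀ : PeriodicConfiguration 3} {R₁ : ℝ} {τ : Finset E3 → ℝ}
    (hD : Dom R₁ τ) (hK : Kepler P₀ R₁ τ) : P₀.energyPerParticle lennardJones = eStar := by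
  refine le_antisymm ?_ (eStar_le P₀)
  refine ge_of_tendsto crysEnergyLimit (Filter.eventually_atTop.2 ⟨1, fun N hN => ?_⟩)
  obtain ⟨x, hx⟩ := LennardJonesGroundStatesExist_holds N
  have h1 := floor hD hK hx.1
  rw [hx.2] at h1
  have hNr : (0 : ℝ) < N := by exact_mod_cast hN
  rw [le_div_iff₀ hNr, mul_comm]
  exact h1

open Summit.AtomisticToContinuum.Crystallization.Theorems.ChargedEnergyGapNegative in
/-- Hence any witness `P₀` is a least element of the periodic energies per particle. [folklore] -/
theorem witness_isLeast {P₀ : PeriodicConfiguration 3} {R₁ : ℝ} {τ : Finset E3 → ℝ}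
    (hD : Dom R₁ τ) (hK : Kepler P₀ R₁ τ) :
    IsLeast (Set.range fun Q : PeriodicConfiguration 3 => Q.energyPerParticle lennardJones)
      (P₀.energyPerParticle lennardJones) := by
  refine ⟨⟨P₀, rfl⟩, ?_⟩
  rintro _ ⟨Q, rfl⟩
  rw [witness_energy_eq_eStar hD hK]
  exact eStar_le Q

/-! ## §3 The LP / balanced-ensemble kill criterion (certified obstruction form)

With `c = 0` the two conjuncts squeeze `T(x) := Σ_i τ(pattern_i(x))` between
`L(x) := Σ_i site₆(x)_i` (DOM) and `U(x) := ½ Σ_i site₁₂(x)_i − 12 N e(P₀)` (KEPLER, `rhs_nonneg`),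
and `T` is ADDITIVE over the multiset of patterns.  So X is refuted by two finite families of
configurations with the same pattern multiset (a "balanced pair") whose `L`-total on one side
exceeds the `U`-total on the other (`e(P₀) = e⋆` for any witness).  By LP duality over the pattern
values this is also the ONLY way the `c = 0` part can fail; on paper every balanced pair reduces to
assemblies of the same pieces across gaps `> R₁`, whose far-`r⁻⁶` surplus (≤ `πρ²/(12 R₁²)` per
unit facing area) loses to `12 ×` the surface energy of the pieces for every `R₁ ≳ 0.5` — and
`R₁ ≥ (12|e⋆|)^{-1/6}` is forced (§2).  Recorded here so that a future witness only has to be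
plugged in. -/

/-- A finite family of finite configurations (sizes may differ). -/
abbrev Family : Type := List (Σ N : ℕ, Fin N → E3)

/-- The pattern multiset of a family at radius `R₁`. -/
def patterns (R₁ : ℝ) (X : Family) : Multiset (Finset E3) :=
  (X.map fun c => (Finset.univ.val.map fun i => pat R₁ c.2 i)).sum

/-- `Σ τ(pattern)` over a family is a function of its pattern multiset. [folklore] -/
theorem sum_tau_eq (R₁ : ℝ) (τ : Finset E3 → ℝ) (X : Family) :
    (X.map fun c => ∑ i, τ (pat R₁ c.2 i)).sum = ((patterns R₁ X).map τ).sum := by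
  induction X with
  | nil => simp [patterns]
  | cons c X ih =>
    simp only [List.map_cons, List.sum_cons, patterns, Multiset.map_add, Multiset.sum_add] at ih ⊢
    rw [ih]
    congr 1
    rw [Multiset.map_map, Finset.sum_eq_multiset_sum]
    rfl

open Summit.AtomisticToContinuum.Crystallization.Theorems.ChargedEnergyGapNegative in
/-- **Kill criterion (balanced pairs).** If for every `R₁ > 0` there are two families `X, Y` of
finite injective configurations with the same `R₁`-pattern multiset and
`Σ_Y (½ Σ site₁₂ − 12 N e⋆) < Σ_X Σ site₆`, then `FluxCellKepler` is false. [folklore] -/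
theorem not_fluxCellKepler_of_balanced
    (h : ∀ R₁ : ℝ, 0 < R₁ → ∃ X Y : Family, (∀ c ∈ X, Function.Injective c.2) ∧
      (∀ c ∈ Y, Function.Injective c.2) ∧ patterns R₁ X = patterns R₁ Y ∧
      (Y.map fun c => (1 / 2 : ℝ) * ∑ i, siteEnergy (fun r => (r⁻¹) ^ 12) c.2 i -
        12 * (c.1 : ℝ) * eStar).sum <
      (X.map fun c => ∑ i, siteEnergy (fun r => (r⁻¹) ^ 6) c.2 i).sum) :
    ¬ FluxCellKepler := by
  rw [fluxCellKepler_iff]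
  rintro ⟨P₀, R₁, τ, hD, hK⟩
  obtain ⟨X, Y, hX, hY, hbal, hlt⟩ := h R₁ hD.R₁_pos
  have he := witness_energy_eq_eStar hD hK
  -- DOM on the X side
  have h1 : (X.map fun c => ∑ i, siteEnergy (fun r => (r⁻¹) ^ 6) c.2 i).sum ≤
      (X.map fun c => ∑ i, τ (pat R₁ c.2 i)).sum :=
    List.sum_le_sum fun c hc => hD c.1 c.2 (hX c hc)
  -- KEPLER (`rhs_nonneg`) on the Y side
  have h2 : (Y.map fun c => ∑ i, τ (pat R₁ c.2 i)).sum ≤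
      (Y.map fun c => (1 / 2 : ℝ) * ∑ i, siteEnergy (fun r => (r⁻¹) ^ 12) c.2 i -
        12 * (c.1 : ℝ) * eStar).sum := by
    refine List.sum_le_sum fun c hc => ?_
    have h0 := hK.rhs_nonneg (hY c hc)
    rw [Finset.sum_sub_distrib, ← Finset.mul_sum, ← Finset.mul_sum, he] at h0
    change _ ≤ (1 / 24 : ℝ) * _ - (1 / 12 : ℝ) * ∑ i, τ (pat R₁ c.2 i) - _ at h0
    linarith
  rw [sum_tau_eq, hbal, ← sum_tau_eq] at h1
  linarith

/-! ## §4 Barlow identification is INSIDE the crux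

KEPLER charges `c(δ,R,η) > 0` for every site whose `R`-neighbourhood is not two-way `η`-matched
with a relaxed Barlow / layered set.  Run it on large blocks of the witness `P₀` itself: by DOM
the right-hand side is at most `E(block) − N e(P₀) = o(N)` (blocks are trial states, tree lemma
`exists_block_energy_le`), so all but `o(N)` block sites are good; deep block sites see exactly
the `P₀`-neighbourhood (tree lemma `exists_eq_toP_of_dist_lt`), and goodness of a site of `P₀`
depends only on its motif class.  Hence EVERY site of `P₀` is `(R, η)`-layered-good, for all
`R, η > 0` (`witness_goodRel`): a witness of X is a periodic Lennard-Jones minimiser (§2b) that is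
locally a relaxed Barlow stacking at every scale — the periodic LJ crystal-STRUCTURE problem
(which polytype / that it is close-packed at all), not only attainment, is inside the crux.
Kill criterion: `not_fluxCellKepler_of_minimisers_not_layered`. -/

/-- The layered (relaxed Barlow) reference set with parameters `a, A, s, z` (verbatim body). -/
def layeredSet (a : ℝ) (A : E3 →ₗᵢ[ℝ] E3) (s : ℤ → ℤ) (z : ℤ → ℝ) : Set E3 :=
  {p | ∃ m k l : ℤ, p = A (((k : ℝ) • triangularVec₁ a) + ((l : ℝ) • triangularVec₂ a) +
    ((haggLabel s m : ℝ) • barlowOffset a) + (z m • layerNormal 1))}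

/-- Two-way `η`-matching on the `R`-ball of a set `V` of relative positions with a reference
set `S`. -/
def Matches (R η : ℝ) (V S : Set E3) : Prop :=
  (∀ p ∈ S, ‖p‖ ≤ R → ∃ v ∈ V, dist v p ≤ η) ∧ (∀ v ∈ V, ‖v‖ ≤ R → ∃ p ∈ S, dist v p ≤ η)

/-- `(R, η)`-layered-goodness of an arbitrary set `V` of relative positions (the crux's defect
predicate, with the finite configuration replaced by `V`). -/
def GoodRel (R η : ℝ) (V : Set E3) : Prop :=
  ∃ a : ℝ, 47 / 50 ≤ a ∧ a ≤ 1 ∧ ∃ (A : E3 →ₗᵢ[ℝ] E3) (s : ℤ → ℤ) (z : ℤ → ℝ), IsHaggSeq s ∧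
    (∀ m : ℤ, 39 / 50 * a ≤ z (m + 1) - z m ∧ z (m + 1) - z m ≤ 17 / 20 * a) ∧
    Matches R η V (layeredSet a A s z)

/-- The crux's predicate is `GoodRel` of the finite set of relative positions. [folklore] -/
theorem good_iff_goodRel (R η : ℝ) {N : ℕ} (x : Fin N → E3) (i : Fin N) :
    Good R η x i ↔ GoodRel R η (Set.range fun j => x j - x i) := by
  unfold Good GoodRel Matches layeredSet
  simp only [Set.forall_mem_range, Set.exists_range_iff]

/-- Goodness passes to a larger set of relative positions that agrees on the `R`-ball. [folklore] -/
theorem GoodRel.mono {R η : ℝ} {V₁ V₂ : Set E3} (h : GoodRel R η V₁) (h12 : V₁ ⊆ V₂)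
    (h21 : ∀ v ∈ V₂, ‖v‖ ≤ R → v ∈ V₁) : GoodRel R η V₂ := by
  obtain ⟨a, ha1, ha2, A, s, z, hs, hz, h1, h2⟩ := h
  refine ⟨a, ha1, ha2, A, s, z, hs, hz, ?_, ?_⟩
  · intro p hp hpR
    obtain ⟨v, hv, hd⟩ := h1 p hp hpR
    exact ⟨v, h12 hv, hd⟩
  · intro v hv hvR
    exact h2 v (h21 v hv hvR) hvR

/-- The set of relative positions of a periodic configuration seen from `y`. -/
def relSet (P : PeriodicConfiguration 3) (y : E3) : Set E3 := {v | y + v ∈ P.points}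

/-- Relative positions are the same from lattice-equivalent points. [folklore] -/
theorem relSet_add (P : PeriodicConfiguration 3) {y g : E3} (hg : g ∈ P.lattice) :
    relSet P (y + g) = relSet P y := by
  ext v
  simp only [relSet, Set.mem_setOf_eq]
  rw [add_right_comm, P.add_mem_points_iff hg]

section Blocks

open Summit.AtomisticToContinuum.Crystallization.Theorems.ChargedEnergyGapNegative
open Summit.AtomisticToContinuum.Crystallization.Theorems.ChargedEnergyGapNegative.Blocks

/-- **Deep block sites see the whole `P`-neighbourhood**: if a `(depth (R+1))`-deep block site
is good in the block, the corresponding site of `P` is good in `P`. [folklore] -/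
theorem goodRel_relSet_of_good (P : PeriodicConfiguration 3) (K : ℕ) {R η : ℝ} {u : BIdx P K}
    (hdeep : IsDeep K (depth P (R + 1)) u.2)
    (hg : Good R η (blockConfig P K) (Fintype.equivFin (BIdx P K) u)) :
    GoodRel R η (relSet P (bpt P K u)) := by
  rw [good_iff_goodRel] at hg
  have hxi : blockConfig P K (Fintype.equivFin (BIdx P K) u) = bpt P K u := by
    rw [blockConfig_apply, Equiv.symm_apply_apply]
  refine hg.mono ?_ ?_
  · rintro _ ⟨j, rfl⟩
    show bpt P K u + (blockConfig P K j - blockConfig P K (Fintype.equivFin _ u)) ∈ P.points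
    rw [hxi, add_sub_cancel, blockConfig_apply]
    exact bpt_mem P K _
  · intro v hv hvR
    by_cases hv0 : v = 0
    · refine ⟨Fintype.equivFin _ u, ?_⟩
      show blockConfig P K (Fintype.equivFin _ u) - blockConfig P K (Fintype.equivFin _ u) = v
      rw [sub_self, hv0]
    · have hq : bpt P K u + v ∈ P.points := hv
      have hne : (⟨bpt P K u + v, hq⟩ : P.points) ≠ toP P K u := by
        intro h
        have h' := congrArg Subtype.val h
        simp only [val_toP] at h'
        exact hv0 (by simpa using h')
      have hlt : dist (bpt P K u) (bpt P K u + v) < R + 1 := by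
        rw [dist_comm, dist_eq_norm, add_sub_cancel_left]
        linarith
      obtain ⟨w, -, hw⟩ := exists_eq_toP_of_dist_lt P K hdeep ⟨bpt P K u + v, hq⟩ hne hlt
      refine ⟨Fintype.equivFin _ w, ?_⟩
      show blockConfig P K (Fintype.equivFin _ w) - blockConfig P K (Fintype.equivFin _ u) = v
      rw [hxi, blockConfig_apply, Equiv.symm_apply_apply]
      have : bpt P K w = bpt P K u + v := congrArg Subtype.val hw
      rw [this, add_sub_cancel_left]

/-- **X ⇒ every site of the witness `P₀` is `(R, η)`-layered-good, for all `R, η > 0`.**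
[folklore] -/
theorem witness_goodRel {P₀ : PeriodicConfiguration 3} {R₁ : ℝ} {τ : Finset E3 → ℝ}
    (hD : Dom R₁ τ) (hK : Kepler P₀ R₁ τ) {R η : ℝ} (hR : 0 < R) (hη : 0 < η) :
    ∀ y ∈ P₀.points, GoodRel R η (relSet P₀ y) := by
  classical
  by_contra hbad
  push Not at hbad
  obtain ⟨y₀, hy₀, hbad⟩ := hbad
  obtain ⟨m₀, hm₀, g₀, hg₀, rfl⟩ := hy₀
  rw [relSet_add P₀ hg₀] at hbad
  -- separation of `P₀`, the KEPLER constant at `(δ₀, R, η)`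
  obtain ⟨δ₀, hδ₀, hsep⟩ := P₀.exists_pos_le_dist
  obtain ⟨c, hc, hKc⟩ := hK δ₀ hδ₀ R η hR hη
  have hF : (0 : ℝ) < P₀.motif.card := by exact_mod_cast P₀.motif_nonempty.card_pos
  -- blocks are trial states with slack `c / (2 #F)` per particle
  obtain ⟨K₀, hK₀, hKE⟩ := exists_block_energy_le P₀ (show 0 < c / (2 * P₀.motif.card) by
    positivity)
  set d : ℕ := depth P₀ (R + 1) with hd
  set K : ℕ := max K₀ (12 * d + 1) with hKdef
  have hKK₀ : K₀ ≤ K := le_max_left _ _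
  have hKd : 12 * d + 1 ≤ K := le_max_right _ _
  set x := blockConfig P₀ K with hxdef
  have hinj : Function.Injective x := blockConfig_injective P₀ K
  have hmem : ∀ i, x i ∈ P₀.points := fun i => by
    rw [hxdef, blockConfig_apply]; exact bpt_mem P₀ K _
  have hsepx : ∀ i j, i ≠ j → δ₀ ≤ dist (x i) (x j) := fun i j hij =>
    hsep _ (hmem i) _ (hmem j) (hinj.ne hij)
  have hkep := hKc _ x hinj hsepx
  change c * (Nat.card {i // ¬ Good R η x i} : ℝ) ≤ _ at hkep
  -- the right-hand side is at most `E(block) − N e(P₀) ≤ N · c/(2#F) = c K³ / 2`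
  have hdom := hD _ x hinj
  have hE := hKE K hKK₀
  have hn : ((Fintype.card (BIdx P₀ K) : ℕ) : ℝ) = P₀.motif.card * (K : ℝ) ^ 3 := by
    exact_mod_cast card_BIdx P₀ K
  rw [← hxdef, hn] at hE
  have hrhs : ∑ i, ((1 / 24 : ℝ) * siteEnergy (fun r => (r⁻¹) ^ 12) x i - (1 / 12 : ℝ) *
      τ ((Finset.univ.filter fun j => dist (x j) (x i) ≤ R₁).image fun j => x j - x i)) ≤
      interactionEnergy lennardJones x := by
    rw [interactionEnergy_eq_sum]
    simp only [Finset.sum_sub_distrib, ← Finset.mul_sum]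
    linarith
  have hslack : (P₀.motif.card : ℝ) * (K : ℝ) ^ 3 * (P₀.energyPerParticle lennardJones +
      c / (2 * P₀.motif.card)) = (P₀.motif.card : ℝ) * (K : ℝ) ^ 3 *
      P₀.energyPerParticle lennardJones + c * (K : ℝ) ^ 3 / 2 := by
    field_simp
  have hN : ((Fintype.card (BIdx P₀ K) : ℕ) : ℝ) = P₀.motif.card * (K : ℝ) ^ 3 := hn
  have hbadle : c * (Nat.card {i // ¬ Good R η x i} : ℝ) ≤ c * (K : ℝ) ^ 3 / 2 := by
    rw [hN] at hkep
    linarith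
  -- deep block sites over `m₀` are bad in the block
  let f : {k : Fin 3 → Fin K // IsDeep K d k} → {i // ¬ Good R η x i} := fun k =>
    ⟨Fintype.equivFin (BIdx P₀ K) (⟨m₀, hm₀⟩, k.1), fun hg => hbad (by
      have := goodRel_relSet_of_good P₀ K (u := (⟨m₀, hm₀⟩, k.1)) k.2 hg
      rwa [bpt, relSet_add P₀ (latVec_mem P₀ _)] at this)⟩
  have hf : Function.Injective f := by
    rintro ⟨k, hk⟩ ⟨k', hk'⟩ h
    have h' := congrArg (fun w => (Fintype.equivFin (BIdx P₀ K)).symm w.1) h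
    simp only [f, Equiv.symm_apply_apply, Prod.mk.injEq, true_and] at h'
    exact Subtype.ext h'
  have hcard := Nat.card_le_card_of_injective f hf
  have hdeep := card_deep_ge K d
  -- numerics: `c (K³ − 6 d K²) ≤ c K³ / 2` forces `K ≤ 12 d`
  have h1 : ((K : ℝ) ^ 3 - 6 * d * (K : ℝ) ^ 2) ≤ (Nat.card {i // ¬ Good R η x i} : ℝ) := by
    have := (Nat.cast_le (α := ℝ)).2 (hdeep.trans (Nat.add_le_add_right hcard _))
    push_cast at this ⊢
    linarith
  have h2 : c * ((K : ℝ) ^ 3 - 6 * d * (K : ℝ) ^ 2) ≤ c * (K : ℝ) ^ 3 / 2 :=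
    (mul_le_mul_of_nonneg_left h1 hc.le).trans hbadle
  have hK1 : (12 * d + 1 : ℝ) ≤ K := by exact_mod_cast hKd
  have hKpos : (0 : ℝ) < K := by linarith [show (0:ℝ) ≤ d from Nat.cast_nonneg d]
  have h3 : c * (K : ℝ) ^ 2 * ((K : ℝ) / 2 - 6 * d) ≤ 0 := by nlinarith
  have h4 : 0 < c * (K : ℝ) ^ 2 := by positivity
  have h5 : (K : ℝ) / 2 - 6 * d ≤ 0 := by
    by_contra h6
    push Not at h6
    linarith [mul_pos h4 h6]
  linarith

end Blocks

open Summit.AtomisticToContinuum.Crystallization.Theorems.ChargedEnergyGapNegative in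
/-- **X ⇒ a periodic Lennard-Jones minimiser that is locally a relaxed Barlow stacking at every
scale**: some least-energy periodic configuration has ALL its sites `(R, η)`-layered-good for
every `R, η > 0`. [folklore] -/
theorem fluxCellKepler_imp_layered_minimiser (h : FluxCellKepler) :
    ∃ P₀ : PeriodicConfiguration 3,
      IsLeast (Set.range fun Q : PeriodicConfiguration 3 => Q.energyPerParticle lennardJones)
        (P₀.energyPerParticle lennardJones) ∧
      ∀ R η : ℝ, 0 < R → 0 < η → ∀ y ∈ P₀.points, GoodRel R η (relSet P₀ y) := by
  obtain ⟨P₀, R₁, τ, hD, hK⟩ := fluxCellKepler_iff.1 h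
  exact ⟨P₀, witness_isLeast hD hK, fun R η hR hη => witness_goodRel hD hK hR hη⟩

/-- **Kill criterion (structure of minimisers).** If every periodic Lennard-Jones minimiser has,
at some scale `(R, η)`, a site whose `R`-neighbourhood is not two-way `η`-matched with any relaxed
Barlow / layered set of the box (`a ∈ [47/50, 1]`, Hägg word, spacings in `[39a/50, 17a/20]`) —
in particular if there is NO periodic minimiser, or if the minimiser is not close-packed — then
`FluxCellKepler` is false. [folklore] -/
theorem not_fluxCellKepler_of_minimisers_not_layered
    (h : ∀ P : PeriodicConfiguration 3,
      IsLeast (Set.range fun Q : PeriodicConfiguration 3 => Q.energyPerParticle lennardJones)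
        (P.energyPerParticle lennardJones) →
      ∃ R η : ℝ, 0 < R ∧ 0 < η ∧ ∃ y ∈ P.points, ¬ GoodRel R η (relSet P y)) :
    ¬ FluxCellKepler := by
  intro hX
  obtain ⟨P₀, hP₀, hgood⟩ := fluxCellKepler_imp_layered_minimiser hX
  obtain ⟨R, η, hR, hη, y, hy, hbad⟩ := h P₀ hP₀
  exact hbad (hgood R η hR hη y hy)

/-! ## §5 The quantifier order `∀ R ∃ c` is load-bearing: `c` uniform in `R` is FALSE

A bounded cluster is ALL-bad at every scale `R ≥ diam + 2` (`not_good_of_forall_norm_le`: the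
layered set matched near the origin contains a whole row `p₀ + t·A u(a)`, `‖A u(a)‖ = a ≤ 1`, hence
a point in the shell `R − 1 < ‖p‖ ≤ R`, which no particle can match).  So with `c` chosen before
`R`, KEPLER on the Lennard-Jones ground states `x^N` (uniformly separated, tree fact) at
`R_N = diam + 2` would give `c · N ≤ E(N) − N e(P₀) = E(N) − N e⋆ = o(N)` — absurd
(`not_dom_and_keplerUniformR`).  For the prover: necessarily `c(δ, R, η) ≲ (E(N) − N e⋆)/N` at
`R ≈ diam(x^N) ~ N^{1/3}`, i.e. `c(R)` decays at least like the surface-to-volume ratio. -/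

/-- Norm of the first triangular generator. [folklore] -/
theorem norm_triangularVec₁ (a : ℝ) : ‖triangularVec₁ a‖ = |a| := by
  rw [EuclideanSpace.norm_eq]
  simp [triangularVec₁, Fin.sum_univ_three, Real.sqrt_sq_eq_abs]

/-- A layered set is invariant under its first in-layer translation: `p ∈ S ⇒ p + t·A u(a) ∈ S`.
[folklore] -/
theorem add_zsmul_mem_layeredSet {a : ℝ} {A : E3 →ₗᵢ[ℝ] E3} {s : ℤ → ℤ} {z : ℤ → ℝ} {p : E3}
    (hp : p ∈ layeredSet a A s z) (t : ℤ) :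
    p + (t : ℝ) • A (triangularVec₁ a) ∈ layeredSet a A s z := by
  obtain ⟨m, k, l, rfl⟩ := hp
  refine ⟨m, k + t, l, ?_⟩
  rw [← A.map_smul, ← A.map_add]
  congr 1
  push_cast
  rw [add_smul]
  abel

/-- **Bounded clusters are all-bad at large scale.** If every relative position at site `i` has
norm `≤ D` and `R ≥ D + 2`, `0 < η ≤ 1/2`, then site `i` is `(R, η)`-bad. [folklore] -/
theorem not_good_of_forall_norm_le {R η D : ℝ} {N : ℕ} {x : Fin N → E3} {i : Fin N}
    (hD : ∀ j, ‖x j - x i‖ ≤ D) (hR : D + 2 ≤ R) (hη : 0 < η) (hη1 : η ≤ 1 / 2) :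
    ¬ Good R η x i := by
  rw [good_iff_goodRel]
  rintro ⟨a, ha1, ha2, A, s, z, -, -, h1, h2⟩
  have hD0 : 0 ≤ D := (norm_nonneg _).trans (hD i)
  -- a point of `S` within `η` of the origin (match of the site itself)
  obtain ⟨p₀, hp₀, hd₀⟩ := h2 (x i - x i) ⟨i, rfl⟩ (by rw [sub_self, norm_zero]; linarith)
  rw [sub_self, dist_comm, dist_zero_right] at hd₀
  -- the row `p₀ + t • A u`
  set w : E3 := A (triangularVec₁ a) with hw
  have hwn : ‖w‖ = a := by
    rw [hw, A.norm_map, norm_triangularVec₁, abs_of_nonneg (by linarith)]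
  have hrow : ∀ t : ℕ, p₀ + (t : ℝ) • w ∈ layeredSet a A s z := fun t => by
    have := add_zsmul_mem_layeredSet hp₀ (t : ℤ)
    simpa using this
  -- some point of the row is beyond `R`
  have hex : ∃ t : ℕ, R < ‖p₀ + (t : ℝ) • w‖ := by
    obtain ⟨t, ht⟩ := exists_nat_gt ((R + 1) / a)
    refine ⟨t, ?_⟩
    have hta : R + 1 < t * a := by rwa [div_lt_iff₀ (by linarith)] at ht
    have : (t : ℝ) * a - ‖p₀‖ ≤ ‖p₀ + (t : ℝ) • w‖ := by
      have h := norm_sub_norm_le ((t : ℝ) • w) (-p₀)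
      rw [norm_neg, sub_neg_eq_add, add_comm, norm_smul, Real.norm_of_nonneg (Nat.cast_nonneg t),
        hwn] at h
      linarith
    linarith
  classical
  -- the last point of the row inside the `R`-ball lies in the shell `(R − 1, R]`
  set t₁ := Nat.find hex with ht₁
  have ht₁R : R < ‖p₀ + (t₁ : ℝ) • w‖ := Nat.find_spec hex
  have ht₁pos : 0 < t₁ := by
    by_contra h0
    have : t₁ = 0 := by omega
    rw [this, Nat.cast_zero, zero_smul, add_zero] at ht₁R
    linarith
  set t₀ := t₁ - 1 with ht₀
  have ht₀le : ‖p₀ + (t₀ : ℝ) • w‖ ≤ R := by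
    have := Nat.find_min hex (show t₀ < t₁ by omega)
    exact not_lt.1 this
  have ht₀ge : R - 1 < ‖p₀ + (t₀ : ℝ) • w‖ := by
    have hsucc : (t₁ : ℝ) = t₀ + 1 := by
      have : t₁ = t₀ + 1 := by omega
      exact_mod_cast this
    have : ‖p₀ + (t₁ : ℝ) • w‖ ≤ ‖p₀ + (t₀ : ℝ) • w‖ + a := by
      rw [hsucc, add_smul, one_smul, ← add_assoc]
      exact (norm_add_le _ _).trans (by rw [hwn])
    linarith
  -- it must be matched by a particle: impossible
  obtain ⟨_, ⟨j, rfl⟩, hj⟩ := h1 _ (hrow t₀) ht₀le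
  dsimp only at hj
  have : ‖p₀ + (t₀ : ℝ) • w‖ ≤ ‖x j - x i‖ + η := by
    have h := norm_le_norm_add_norm_sub' (p₀ + (t₀ : ℝ) • w) (x j - x i)
    rw [← dist_eq_norm (p₀ + (t₀ : ℝ) • w) (x j - x i), dist_comm] at h
    linarith
  linarith [hD j]

/-- KEPLER with the defect price `c` chosen BEFORE the scale `R` and the tolerance `η`
(a natural strengthening of the crux's `∀ δ R η, ∃ c`). [folklore] -/
def KeplerUniformR (P₀ : PeriodicConfiguration 3) (R₁ : ℝ) (τ : Finset E3 → ℝ) : Prop :=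
  ∀ δ : ℝ, 0 < δ → ∃ c : ℝ, 0 < c ∧ ∀ R η : ℝ, 0 < R → 0 < η → ∀ (N : ℕ) (x : Fin N → E3),
    Function.Injective x → (∀ i j, i ≠ j → δ ≤ dist (x i) (x j)) →
    c * (Nat.card {i : Fin N // ¬ Good R η x i} : ℝ) ≤
    ∑ i, ((1 / 24 : ℝ) * siteEnergy (fun r => (r⁻¹) ^ 12) x i - (1 / 12 : ℝ) *
      τ ((Finset.univ.filter fun j : Fin N => dist (x j) (x i) ≤ R₁).image fun j => x j - x i)) -
      (N : ℝ) * P₀.energyPerParticle lennardJones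

/-- The uniform version implies the crux's KEPLER. [folklore] -/
theorem KeplerUniformR.kepler {P₀ : PeriodicConfiguration 3} {R₁ : ℝ} {τ : Finset E3 → ℝ}
    (h : KeplerUniformR P₀ R₁ τ) : Kepler P₀ R₁ τ := by
  intro δ hδ R η hR hη
  obtain ⟨c, hc, hK⟩ := h δ hδ
  exact ⟨c, hc, hK R η hR hη⟩

open Summit.AtomisticToContinuum.Crystallization.Theorems.ChargedEnergyGapNegative in
/-- **The strengthening with `c` uniform in `R` is false** (witness: the Lennard-Jones ground
states at scale `R = diam + 2`, all of whose sites are bad, against `E(N) − N e⋆ = o(N)`).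
[folklore] -/
theorem not_dom_and_keplerUniformR :
    ¬ ∃ (P₀ : PeriodicConfiguration 3) (R₁ : ℝ) (τ : Finset E3 → ℝ),
      Dom R₁ τ ∧ KeplerUniformR P₀ R₁ τ := by
  rintro ⟨P₀, R₁, τ, hD, hU⟩
  have hK := hU.kepler
  have he := witness_energy_eq_eStar hD hK
  obtain ⟨δ₀, hδ₀, hsepGS⟩ := LennardJonesMinimalDistance_holds
  obtain ⟨c, hc, hKc⟩ := hU δ₀ hδ₀
  -- `E(N)/N → e⋆`: pick `N ≥ 1` with `E(N)/N < e⋆ + c/2`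
  have hlim := crysEnergyLimit
  have hev : ∀ᶠ N : ℕ in Filter.atTop, groundStateEnergy lennardJones 3 N / N < eStar + c / 2 :=
    hlim (Iio_mem_nhds (by change eStar < eStar + c / 2; linarith))
  obtain ⟨N, hN₀⟩ := Filter.eventually_atTop.1 (hev.and (Filter.eventually_ge_atTop 1))
  obtain ⟨hN, hN1⟩ := hN₀ N le_rfl
  obtain ⟨x, hx⟩ := LennardJonesGroundStatesExist_holds N
  -- all sites of `x` are `(R, 1/2)`-bad at `R = D + 2`, `D = 2 Σ ‖x i‖`
  set D : ℝ := 2 * ∑ i, ‖x i‖ with hDdef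
  have hDij : ∀ i j, ‖x j - x i‖ ≤ D := fun i j => by
    have hi : ‖x i‖ ≤ ∑ k, ‖x k‖ :=
      Finset.single_le_sum (fun k _ => norm_nonneg (x k)) (Finset.mem_univ i)
    have hj : ‖x j‖ ≤ ∑ k, ‖x k‖ :=
      Finset.single_le_sum (fun k _ => norm_nonneg (x k)) (Finset.mem_univ j)
    calc ‖x j - x i‖ ≤ ‖x j‖ + ‖x i‖ := norm_sub_le _ _
      _ ≤ D := by rw [hDdef]; linarith
  have hD0 : 0 ≤ D := by rw [hDdef]; positivity
  have hbad : ∀ i, ¬ Good (D + 2) (1 / 2) x i := fun i =>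
    not_good_of_forall_norm_le (hDij i) le_rfl (by norm_num) le_rfl
  have hcard : Nat.card {i : Fin N // ¬ Good (D + 2) (1 / 2) x i} = N := by
    rw [Nat.card_congr (Equiv.subtypeUnivEquiv hbad), Nat.card_eq_fintype_card, Fintype.card_fin]
  have hkep := hKc (D + 2) (1 / 2) (by linarith) (by norm_num) N x hx.1 (hsepGS N x hx)
  rw [hcard] at hkep
  -- the right-hand side is at most `E(N) − N e⋆`
  have hdom := hD N x hx.1
  have hrhs : ∑ i, ((1 / 24 : ℝ) * siteEnergy (fun r => (r⁻¹) ^ 12) x i - (1 / 12 : ℝ) *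
      τ ((Finset.univ.filter fun j => dist (x j) (x i) ≤ R₁).image fun j => x j - x i)) ≤
      interactionEnergy lennardJones x := by
    rw [interactionEnergy_eq_sum]
    simp only [Finset.sum_sub_distrib, ← Finset.mul_sum]
    linarith
  rw [hx.2] at hrhs
  have hNr : (0 : ℝ) < N := by exact_mod_cast hN1
  rw [div_lt_iff₀ hNr] at hN
  rw [he] at hkep
  nlinarith

/-! ## §6 The periodic twin: X prices bad motif classes of EVERY periodic configuration

Same block argument with an arbitrary periodic `Q` in place of `P₀`: for every `(δ, R, η)` the
KEPLER constant `c` satisfies `c · #{bad motif classes of Q} ≤ #F · (e(Q) − e⋆)` for every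
`δ`-separated periodic `Q` (`periodicPricing`).  Kill criterion for a COMPUTATION: a sequence of
uniformly separated periodic configurations, `(R, η)`-bad at a positive fraction of their motif,
with `e(Q) → e⋆` faster than the bad fraction (`not_fluxCellKepler_of_cheap_bad_periodic`) — i.e. a
non-close-packed structure tying the Lennard-Jones periodic ground-state energy.  None is known
(bcc, A15, σ, C15, glasses all sit ≥ 2 % above `e(hcp*)` for LJ 12-6), which is WHY the crux
resists. -/

section Periodic

open Summit.AtomisticToContinuum.Crystallization.Theorems.ChargedEnergyGapNegative
open Summit.AtomisticToContinuum.Crystallization.Theorems.ChargedEnergyGapNegative.Blocks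

/-- Number of `(R, η)`-bad motif classes of a periodic configuration. [folklore] -/
def motifBad (R η : ℝ) (Q : PeriodicConfiguration 3) : ℕ :=
  Nat.card {m : Q.motif // ¬ GoodRel R η (relSet Q m)}

/-- `motifBad ≤ #F`. [folklore] -/
theorem motifBad_le (R η : ℝ) (Q : PeriodicConfiguration 3) : motifBad R η Q ≤ Q.motif.card := by
  classical
  unfold motifBad
  rw [Nat.card_eq_fintype_card, ← Fintype.card_coe Q.motif]
  exact Fintype.card_subtype_le _

/-- **Periodic pricing.** Under X, for every `(δ, R, η)` there is `c > 0` with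
`c · motifBad R η Q ≤ #F · (e(Q) − e⋆)` for every `δ`-separated periodic `Q`. [folklore] -/
theorem periodicPricing {P₀ : PeriodicConfiguration 3} {R₁ : ℝ} {τ : Finset E3 → ℝ}
    (hD : Dom R₁ τ) (hK : Kepler P₀ R₁ τ) {δ R η : ℝ} (hδ : 0 < δ) (hR : 0 < R) (hη : 0 < η) :
    ∃ c : ℝ, 0 < c ∧ ∀ Q : PeriodicConfiguration 3,
      (∀ p ∈ Q.points, ∀ q ∈ Q.points, p ≠ q → δ ≤ dist p q) →
      c * (motifBad R η Q : ℝ) ≤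
        (Q.motif.card : ℝ) * (Q.energyPerParticle lennardJones - eStar) := by
  classical
  obtain ⟨c, hc, hKc⟩ := hK δ hδ R η hR hη
  have he := witness_energy_eq_eStar hD hK
  refine ⟨c, hc, fun Q hsep => ?_⟩
  by_contra hlt
  push Not at hlt
  have hF : (0 : ℝ) < Q.motif.card := by exact_mod_cast Q.motif_nonempty.card_pos
  set gap : ℝ := c * (motifBad R η Q : ℝ) -
    (Q.motif.card : ℝ) * (Q.energyPerParticle lennardJones - eStar) with hgap
  have hgap0 : 0 < gap := by rw [hgap]; linarith
  obtain ⟨K₀, hK₀, hKE⟩ := exists_block_energy_le Q (show 0 < gap / (3 * Q.motif.card) by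
    positivity)
  set d : ℕ := depth Q (R + 1) with hd
  obtain ⟨K₁, hK₁⟩ := exists_nat_gt (18 * d * c * (motifBad R η Q : ℝ) / gap)
  set K : ℕ := max K₀ (K₁ + 1) with hKdef
  have hKK₀ : K₀ ≤ K := le_max_left _ _
  have hKK₁ : K₁ + 1 ≤ K := le_max_right _ _
  have hK1r : (K₁ : ℝ) + 1 ≤ K := by exact_mod_cast hKK₁
  have hKpos : (0 : ℝ) < K := by linarith [show (0 : ℝ) ≤ K₁ from Nat.cast_nonneg K₁]
  set x := blockConfig Q K with hxdef
  have hinj : Function.Injective x := blockConfig_injective Q K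
  have hmem : ∀ i, x i ∈ Q.points := fun i => by
    rw [hxdef, blockConfig_apply]; exact bpt_mem Q K _
  have hsepx : ∀ i j, i ≠ j → δ ≤ dist (x i) (x j) := fun i j hij =>
    hsep _ (hmem i) _ (hmem j) (hinj.ne hij)
  have hkep := hKc _ x hinj hsepx
  change c * (Nat.card {i // ¬ Good R η x i} : ℝ) ≤ _ at hkep
  have hdom := hD _ x hinj
  have hE := hKE K hKK₀
  have hn : ((Fintype.card (BIdx Q K) : ℕ) : ℝ) = Q.motif.card * (K : ℝ) ^ 3 := by
    exact_mod_cast card_BIdx Q K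
  rw [← hxdef, hn] at hE
  have hrhs : ∑ i, ((1 / 24 : ℝ) * siteEnergy (fun r => (r⁻¹) ^ 12) x i - (1 / 12 : ℝ) *
      τ ((Finset.univ.filter fun j => dist (x j) (x i) ≤ R₁).image fun j => x j - x i)) ≤
      interactionEnergy lennardJones x := by
    rw [interactionEnergy_eq_sum]
    simp only [Finset.sum_sub_distrib, ← Finset.mul_sum]
    linarith
  rw [hn, he] at hkep
  -- bad block sites: at least `(#deep) · motifBad`
  let f : {k : Fin 3 → Fin K // IsDeep K d k} × {m : Q.motif // ¬ GoodRel R η (relSet Q m)} →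
      {i // ¬ Good R η x i} := fun p =>
    ⟨Fintype.equivFin (BIdx Q K) (p.2.1, p.1.1), fun hg => p.2.2 (by
      have := goodRel_relSet_of_good Q K (u := (p.2.1, p.1.1)) p.1.2 hg
      rwa [bpt, relSet_add Q (latVec_mem Q _)] at this)⟩
  have hf : Function.Injective f := by
    rintro ⟨⟨k, hk⟩, ⟨m, hm⟩⟩ ⟨⟨k', hk'⟩, ⟨m', hm'⟩⟩ h
    have h' := congrArg (fun w => (Fintype.equivFin (BIdx Q K)).symm w.1) h
    simp only [f, Equiv.symm_apply_apply, Prod.mk.injEq] at h'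
    obtain ⟨rfl, rfl⟩ := h'
    rfl
  have hcard := Nat.card_le_card_of_injective f hf
  rw [Nat.card_prod] at hcard
  have hdeep := card_deep_ge K d
  have h1 : ((K : ℝ) ^ 3 - 6 * d * (K : ℝ) ^ 2) * (motifBad R η Q : ℝ) ≤
      (Nat.card {i // ¬ Good R η x i} : ℝ) := by
    have hdk : ((K : ℝ) ^ 3 - 6 * d * (K : ℝ) ^ 2) ≤
        (Nat.card {k : Fin 3 → Fin K // IsDeep K d k} : ℝ) := by
      have := (Nat.cast_le (α := ℝ)).2 hdeep; push_cast at this ⊢; linarith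
    have h2 : ((Nat.card {k : Fin 3 → Fin K // IsDeep K d k} : ℕ) : ℝ) * (motifBad R η Q : ℝ) ≤
        (Nat.card {i // ¬ Good R η x i} : ℝ) := by exact_mod_cast hcard
    nlinarith [Nat.cast_nonneg (α := ℝ) (motifBad R η Q)]
  -- `6 d c mB K² ≤ (gap/3) K³`
  have hsmall : 6 * d * c * (motifBad R η Q : ℝ) * (K : ℝ) ^ 2 ≤ gap / 3 * (K : ℝ) ^ 3 := by
    have h3 : 18 * d * c * (motifBad R η Q : ℝ) / gap < K := by linarith
    rw [div_lt_iff₀ hgap0] at h3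
    have hK2 : (0 : ℝ) ≤ (K : ℝ) ^ 2 := by positivity
    nlinarith
  have hK3 : (0 : ℝ) < (K : ℝ) ^ 3 := by positivity
  have key : (K : ℝ) ^ 3 * (c * (motifBad R η Q : ℝ) - gap / 3) ≤
      (K : ℝ) ^ 3 *
        ((Q.motif.card : ℝ) * (Q.energyPerParticle lennardJones - eStar) + gap / 3) := by
    have hE' : interactionEnergy lennardJones x ≤
        (Q.motif.card : ℝ) * (K : ℝ) ^ 3 * Q.energyPerParticle lennardJones +
          (K : ℝ) ^ 3 * (gap / 3) := by
      have : (Q.motif.card : ℝ) * (K : ℝ) ^ 3 * (gap / (3 * Q.motif.card)) =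
          (K : ℝ) ^ 3 * (gap / 3) := by
        field_simp
      nlinarith
    have hc1 := mul_le_mul_of_nonneg_left h1 hc.le
    nlinarith
  have := le_of_mul_le_mul_left key hK3
  rw [hgap] at this
  linarith

/-- **Kill criterion (cheap bad periodic competitors).** If for some `(δ, R, η)` and every
`κ > 0` there is a `δ`-separated periodic `Q` with `#F · (e(Q) − e⋆) < κ · motifBad R η Q`, then
`FluxCellKepler` is false. [folklore] -/
theorem not_fluxCellKepler_of_cheap_bad_periodic {δ R η : ℝ} (hδ : 0 < δ) (hR : 0 < R)
    (hη : 0 < η)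
    (h : ∀ κ : ℝ, 0 < κ → ∃ Q : PeriodicConfiguration 3,
      (∀ p ∈ Q.points, ∀ q ∈ Q.points, p ≠ q → δ ≤ dist p q) ∧
      (Q.motif.card : ℝ) * (Q.energyPerParticle lennardJones - eStar) <
        κ * (motifBad R η Q : ℝ)) :
    ¬ FluxCellKepler := by
  rw [fluxCellKepler_iff]
  rintro ⟨P₀, R₁, τ, hD, hK⟩
  obtain ⟨c, hc, hP⟩ := periodicPricing hD hK hδ hR hη
  obtain ⟨Q, hsep, hlt⟩ := h c hc
  exact absurd (hP Q hsep) (not_le.2 hlt)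

end Periodic

/-! ## -- Targets (lead's stuck stubs): none yet (payload.stuck_stubs = []).

## -- Line `birth` (skeleton 5e703f0e…, stubs registered 2026-08-17) — paper triage of the stubs

* `stub_periodicMinimiser` (= item 0627): NECESSARY for X (`witness_isLeast`); open, no attack.
* `stub_defectPricedExcess` (τ-free pricing `c·#bad ≤ E − N e⋆`): NECESSARY for X (floor + DOM, the
  lead's `stub_cruxNecessity`); every attack on it is an attack on X — see §4–§6 (kill criteria) and
  the index docblock (why no witness family is known).  Its `c` must decay in `R` (§5) and, on
  paper, like `μ (η/R)²` in `η` (uniform shear) — provers should not try to prove it with `c`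
  independent of `R` or `η`.
* `stub_coerciveFluxCells` (∃ R₁ τ, DOM ∧ ∀ δ ∃ θ < 1, `Στ − Σsite₆ ≤ 12 θ (E − N e⋆)`): NOT implied by
  X (X gives θ = 1).  Cheap probes, all consistent: one point ⇒ `τ{0} ≤ 12 θ(δ) |e⋆|` for every δ,
  and DOM ⇒ `τ{0} ≥ R₁⁻⁶`, so `θ(δ) ≥ R₁⁻⁶ /(12|e⋆|)` UNIFORMLY in δ (θ cannot tend to 0; with
  `R₁ = 1.1`, θ ≥ 0.047); DOM on (chunk ⊔ copy at gap R₁) forces an over-credit `≥ Σ_cross r⁻⁶` on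
  every isolated chunk (≈ `π²ρ² L /(12 R₁)` for two balls of radius `L`), negligible against
  `12 θ · 4π L² σ`; the LP obstruction of the θ-clause is the balanced-pair surplus of §3 with `12`
  replaced by `12 θ` — dead for `R₁ ≳ 0.6/√θ`.  The real risk named by the card (a soft mode of the
  cell functional, `𝔖'' = 12 E''` in a phonon direction) is a statement about the INTENDED flux-cell
  τ and is invisible to these probes; numerically it is the `q = 0` strained-hcp test (not run here;
  the bcc cell test of this session, job in NOTES, probes only the kill of `q = 0` by a competitor).
* `stub_domSatisfiable` (K-cell counting form of DOM at `R₁ = 4`): TRUE on paper — far pairs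
  `(i, j)`, `r > 4`, are charged to unit cells `Q ∋ x_i`, `Q' ∋ x_j`:
  `Σ_far r⁻⁶ ≤ Σ_{Q,Q'} n_Q n_Q' d(Q,Q')⁻⁶ ≤ C Σ_Q n_Q² ≤ C Σ_i #pattern_i` (points of one unit cell
  are pairwise within `√3 < 4`).  Not a target.
* `stub_energyIdentity`, `stub_transferPrinciple`, `stub_keplerOfPointwise`: algebra, true
  (`interactionEnergy_eq_sum` here is the first).
-/

end Summit.AtomisticToContinuum.Crystallization.Cruxes.FluxCellKepler.Disproof

end
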